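import Summits.HodgeConjecture.CorCM.MumfordTateRankEqHodgeLieRankAddOne
import Literature.AlgebraicGeometry.Motives.HodgeLieDerivedSemisimple
import Literature.AlgebraicGeometry.HodgeTheory.NoTypeIVTimesCMInvariance
import Literature.Algebra.Lie.SemisimpleSmallDimension
import HarnessLib

/-!
# `Lie Hg(H¹X)` is REDUCTIVE for every complex abelian variety: centre `⊕` semisimple derived algebra, and the
# small-dimension table `dim [Lie Hg, Lie Hg] ∉ {1, 2, 4, 5, 7}`

COR-CM (cell `pub-hodgecm2`, seat `b27` gen 36, count-neutral lane MT-REDUCTIVE; theorems only, no definition, no named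
fact; UNCONDITIONAL — nothing here uses or asserts HC_CM).  For a complex abelian variety `X` write `H = H¹(X(ℂ); ℚ)`
(weight `1`, effective, polarized by the Riemann form), `𝔥 = Lie Hg(H¹X) = H.hodgeLie`,
`𝔷 = 𝔥 ∩ End_Hdg(H¹X)` (`= 𝔥 ⊓ Subalgebra.toSubmodule H.endAlg`, the CENTRE of `𝔥`, `hodgeLie_center_eq_inf_endAlg`) and
`𝔡 = [𝔥, 𝔥] = span_ℚ {XY - YX : X, Y ∈ 𝔥}` (the DERIVED algebra).  The Literature theorems of this lane
(`Motives/HodgeThetaSubalgebraReductive`, `Motives/HodgeLieDerivedSemisimple`, `Algebra/Lie/TraceSeparatingCenterDerived`,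
`Algebra/Lie/CentralRadicalOfCompletelyReducible`, `Algebra/Lie/SemisimpleSmallDimension`) specialised to `H¹X`:

* **`hodgeLie_hodge_one_center_sup_derived`**, `…_center_inf_derived`, `finrank_hodgeLie_hodge_one_eq_center_add_derived` —
  `𝔥 = 𝔷 ⊕ 𝔡` (Deligne I 3.6 / Moonen–Zarhin §1: «`Hg(X)` is a connected reductive group»; Lie form);
* **`mtRank_hodge_one_eq_center_add_derived_add_one`** — `dim MT(H¹X) = dim 𝔷 + dim 𝔡 + 1` (`0 < dim X`; gen 35's
  `dim MT = dim Lie Hg + 1`);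
* **`isOfCMType_iff_hodgeLie_derived_eq_bot`** — `X` is of CM type iff `𝔡 = 0` (iff `𝔥` is abelian);
* **`isSemisimple_of_eq_hodgeLie_hodge_one_derived`** — `𝔡` is a SEMISIMPLE Lie algebra (Mathlib `LieAlgebra.IsSemisimple ℚ`
  and `HasTrivialRadical`, for every Lie subalgebra of `𝔤𝔩(H¹X)` with carrier `𝔡`; commutator bracket
  `LieRing.ofAssociativeRing` supplied by a `letI`);
* **`finrank_hodgeLie_hodge_one_derived_ne`** — `dim 𝔡 ∉ {1, 2, 4, 5, 7}`; `three_le_finrank_hodgeLie_hodge_one_derived`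
  (`X` not CM ⟹ `dim 𝔡 ≥ 3`, and `≥ 6` unless `= 3`);
* `hodgeLie_hodge_one_abelian_ideal_le_center` — every abelian ideal of `𝔥` is central;
* **`hodgeLie_hodge_one_inf_endAlg_eq_bot_of_hasNoTypeIVFactor`**, `hodgeLie_hodge_one_derived_eq_of_hasNoTypeIVFactor`,
  `isSemisimple_of_eq_hodgeLie_hodge_one_of_hasNoTypeIVFactor` — «if `X` has no factor of type IV then `Hg(X)` is
  semisimple» (Moonen–Zarhin §1): `𝔷 = 0`, `𝔥 = 𝔡`; `mtRank_hodge_one_ne_of_hasNoTypeIVFactor` (`dim MT(H¹X) ∉ {3, 6}` —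
  with the earlier rungs `∉ {2, 5, 8}` read as `dim Lie Hg ∉ {1, 2, 4, 5, 7}`).

## References
* [Deligne1982HodgeCycles] P. Deligne, *Hodge cycles on abelian varieties*, LNM 900 (1982), I Prop. 3.6.
* [MoonenZarhin1999LowDim] B. Moonen, Yu. Zarhin, Math. Ann. 315 (1999), §1–§2.
* [Humphreys1972] J. E. Humphreys, GTM 9, §19.1, §8.4.
-/

noncomputable section

open CategoryTheory CategoryTheory.Limits Module
open scoped BigOperators TensorProduct

namespace Summit.HodgeConjecture.CorCM

open Literature.AlgebraicGeometry.Motives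
open Literature.AlgebraicGeometry.Motives.AbelianVariety
open Literature.AlgebraicGeometry.Motives.HodgeStructure
open Literature.AlgebraicGeometry.HodgeTheory
open Literature.AlgebraicGeometry.Milne1999 (IsOfCMType)

variable [HodgeTensorFacts.{0, 0}] {X : AbelianVariety ℂ} {n : ℕ}

/-! ### `𝔥 = 𝔷 ⊕ 𝔡` -/

/-- **`Lie Hg(H¹X) = (Lie Hg ∩ End_Hdg) ⊕ [Lie Hg, Lie Hg]`, sum part** — for every complex abelian variety (Deligne I 3.6;
Moonen–Zarhin §1: `Hg(X)` is reductive, its centre lies in `End⁰(X)`). [cite: Deligne1982HodgeCycles, I §3 Prop. 3.6]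
[cite: MoonenZarhin1999LowDim, §1] -/
theorem hodgeLie_hodge_one_center_sup_derived (hX : IsSmoothProjective n X.X) :
    haveI := BettiUniverse.finite hX 1
    (BettiUniverse.hodge exists_isReal_hodgeModel_holds hX 1).hodgeLie ⊓
        Subalgebra.toSubmodule (BettiUniverse.hodge exists_isReal_hodgeModel_holds hX 1).endAlg ⊔
      Submodule.span ℚ {B | ∃ X' ∈ (BettiUniverse.hodge exists_isReal_hodgeModel_holds hX 1).hodgeLie,
        ∃ Y ∈ (BettiUniverse.hodge exists_isReal_hodgeModel_holds hX 1).hodgeLie, X' * Y - Y * X' = B} =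
      (BettiUniverse.hodge exists_isReal_hodgeModel_holds hX 1).hodgeLie := by
  haveI := BettiUniverse.finite hX 1
  obtain ⟨ψ⟩ := BettiUniverse.hodge_isPolarizable exists_isReal_hodgeModel_holds hX 1
  exact hodgeLie_center_sup_derived_eq _ (by simp) (BettiUniverse.hodge_isEffective _ hX 1) ψ

/-- **Intersection part: `(Lie Hg ∩ End_Hdg) ∩ [Lie Hg, Lie Hg] = 0`.** [cite: Deligne1982HodgeCycles, I §3 Prop. 3.6]
[cite: MoonenZarhin1999LowDim, §1] -/
theorem hodgeLie_hodge_one_center_inf_derived (hX : IsSmoothProjective n X.X) :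
    haveI := BettiUniverse.finite hX 1
    (BettiUniverse.hodge exists_isReal_hodgeModel_holds hX 1).hodgeLie ⊓
        Subalgebra.toSubmodule (BettiUniverse.hodge exists_isReal_hodgeModel_holds hX 1).endAlg ⊓
      Submodule.span ℚ {B | ∃ X' ∈ (BettiUniverse.hodge exists_isReal_hodgeModel_holds hX 1).hodgeLie,
        ∃ Y ∈ (BettiUniverse.hodge exists_isReal_hodgeModel_holds hX 1).hodgeLie, X' * Y - Y * X' = B} = ⊥ := by
  haveI := BettiUniverse.finite hX 1
  obtain ⟨ψ⟩ := BettiUniverse.hodge_isPolarizable exists_isReal_hodgeModel_holds hX 1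
  exact hodgeLie_center_inf_derived_eq_bot _ ψ

/-- **`dim Lie Hg(H¹X) = dim 𝔷 + dim 𝔡`.** [cite: Deligne1982HodgeCycles, I §3 Prop. 3.6] [cite: Humphreys1972, §19.1] -/
theorem finrank_hodgeLie_hodge_one_eq_center_add_derived (hX : IsSmoothProjective n X.X) :
    haveI := BettiUniverse.finite hX 1
    Module.finrank ℚ (BettiUniverse.hodge exists_isReal_hodgeModel_holds hX 1).hodgeLie =
      Module.finrank ℚ ↥((BettiUniverse.hodge exists_isReal_hodgeModel_holds hX 1).hodgeLie ⊓
          Subalgebra.toSubmodule (BettiUniverse.hodge exists_isReal_hodgeModel_holds hX 1).endAlg) +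
        Module.finrank ℚ ↥(Submodule.span ℚ {B | ∃ X' ∈ (BettiUniverse.hodge exists_isReal_hodgeModel_holds hX 1).hodgeLie,
          ∃ Y ∈ (BettiUniverse.hodge exists_isReal_hodgeModel_holds hX 1).hodgeLie, X' * Y - Y * X' = B}) := by
  haveI := BettiUniverse.finite hX 1
  obtain ⟨ψ⟩ := BettiUniverse.hodge_isPolarizable exists_isReal_hodgeModel_holds hX 1
  exact finrank_hodgeLie_eq_center_add_derived _ (by simp) (BettiUniverse.hodge_isEffective _ hX 1) ψ

/-- **`dim MT(H¹X) = dim 𝔷 + dim 𝔡 + 1`** (`0 < dim X`; `dim MT = dim Lie Hg + 1`, gen 35, and `𝔥 = 𝔷 ⊕ 𝔡`).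
[cite: MoonenZarhin1999LowDim, §1–§2] [cite: Deligne1982HodgeCycles, I §3 Prop. 3.6] -/
theorem mtRank_hodge_one_eq_center_add_derived_add_one (hX : IsSmoothProjective n X.X) (h0 : 0 < X.dim) :
    haveI := BettiUniverse.finite hX 1
    (BettiUniverse.hodge exists_isReal_hodgeModel_holds hX 1).mtRank =
      Module.finrank ℚ ↥((BettiUniverse.hodge exists_isReal_hodgeModel_holds hX 1).hodgeLie ⊓
          Subalgebra.toSubmodule (BettiUniverse.hodge exists_isReal_hodgeModel_holds hX 1).endAlg) +
        Module.finrank ℚ ↥(Submodule.span ℚ {B | ∃ X' ∈ (BettiUniverse.hodge exists_isReal_hodgeModel_holds hX 1).hodgeLie,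
          ∃ Y ∈ (BettiUniverse.hodge exists_isReal_hodgeModel_holds hX 1).hodgeLie, X' * Y - Y * X' = B}) + 1 := by
  rw [mtRank_hodge_one_eq_finrank_hodgeLie_add_one hX h0, finrank_hodgeLie_hodge_one_eq_center_add_derived hX]

/-! ### The CM criterion and the semisimple part -/

/-- **`X` is of CM type iff `[Lie Hg(H¹X), Lie Hg(H¹X)] = 0`** (iff `Lie Hg` is abelian, iff `Lie Hg ⊆ End_Hdg`; the tree's
`isOfCMType_iff_mumfordTateLieAlgebra_le_endAlg` read on the decomposition). [cite: MoonenZarhin1999LowDim, §2]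
[cite: Deligne1982HodgeCycles, I §3 Prop. 3.6] -/
theorem isOfCMType_iff_hodgeLie_derived_eq_bot (hX : IsSmoothProjective n X.X) :
    haveI := BettiUniverse.finite hX 1
    IsOfCMType X ↔
      Submodule.span ℚ {B | ∃ X' ∈ (BettiUniverse.hodge exists_isReal_hodgeModel_holds hX 1).hodgeLie,
        ∃ Y ∈ (BettiUniverse.hodge exists_isReal_hodgeModel_holds hX 1).hodgeLie, X' * Y - Y * X' = B} = ⊥ := by
  haveI := BettiUniverse.finite hX 1
  obtain ⟨ψ⟩ := BettiUniverse.hodge_isPolarizable exists_isReal_hodgeModel_holds hX 1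
  rw [isOfCMType_iff_mumfordTateLieAlgebra_le_endAlg hX, ← hodgeLie_le_endAlg_iff,
    hodgeLie_derived_eq_bot_iff_le_endAlg _ (by simp) (BettiUniverse.hodge_isEffective _ hX 1) ψ]

/-- **`[Lie Hg(H¹X), Lie Hg(H¹X)]` is a semisimple Lie algebra** — for every Lie subalgebra `𝔏 ≤ 𝔤𝔩(H¹X)` (commutator
bracket) with carrier `𝔡`: `LieAlgebra.IsSemisimple ℚ 𝔏` and `LieAlgebra.HasTrivialRadical ℚ 𝔏` (positivity of the Hodge
form + Lie's theorem + Cartan's criterion, `isSemisimple_of_eq_hodgeLie_derived`); with `hodgeLie_hodge_one_center_sup_derived`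
this is «`Lie Hg(H¹X)` is reductive». [cite: Deligne1982HodgeCycles, I §3 Prop. 3.6] [cite: MoonenZarhin1999LowDim, §1]
[cite: Humphreys1972, §19.1] -/
theorem isSemisimple_of_eq_hodgeLie_hodge_one_derived (hX : IsSmoothProjective n X.X) :
    haveI := BettiUniverse.finite hX 1
    letI : LieRing (Module.End ℚ (bettiCohomology X.X 1)) := LieRing.ofAssociativeRing
    ∀ 𝔏 : LieSubalgebra ℚ (Module.End ℚ (bettiCohomology X.X 1)),
      𝔏.toSubmodule = Submodule.span ℚ {B | ∃ X' ∈ (BettiUniverse.hodge exists_isReal_hodgeModel_holds hX 1).hodgeLie,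
        ∃ Y ∈ (BettiUniverse.hodge exists_isReal_hodgeModel_holds hX 1).hodgeLie, X' * Y - Y * X' = B} →
      LieAlgebra.IsSemisimple ℚ 𝔏 ∧ LieAlgebra.HasTrivialRadical ℚ 𝔏 := by
  haveI := BettiUniverse.finite hX 1
  letI : LieRing (Module.End ℚ (bettiCohomology X.X 1)) := LieRing.ofAssociativeRing
  intro 𝔏 h𝔏
  obtain ⟨ψ⟩ := BettiUniverse.hodge_isPolarizable exists_isReal_hodgeModel_holds hX 1
  exact ⟨isSemisimple_of_eq_hodgeLie_derived _ (by simp) (BettiUniverse.hodge_isEffective _ hX 1) ψ 𝔏 h𝔏,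
    hasTrivialRadical_of_eq_hodgeLie_derived _ (by simp) (BettiUniverse.hodge_isEffective _ hX 1) ψ 𝔏 h𝔏⟩

/-- **`dim [Lie Hg(H¹X), Lie Hg(H¹X)] ∉ {1, 2, 4, 5, 7}`** — a semisimple Lie algebra over `ℚ` has dimension
`rank + #roots` with `#roots` even and `≥ 2·rank` (`SemisimpleSmallDimension.finrank_ne_of_hasTrivialRadical`).
[cite: Humphreys1972, §8.4] [cite: Deligne1982HodgeCycles, I §3 Prop. 3.6] -/
theorem finrank_hodgeLie_hodge_one_derived_ne (hX : IsSmoothProjective n X.X) :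
    haveI := BettiUniverse.finite hX 1
    Module.finrank ℚ ↥(Submodule.span ℚ {B | ∃ X' ∈ (BettiUniverse.hodge exists_isReal_hodgeModel_holds hX 1).hodgeLie,
        ∃ Y ∈ (BettiUniverse.hodge exists_isReal_hodgeModel_holds hX 1).hodgeLie, X' * Y - Y * X' = B}) ≠ 1 ∧
    Module.finrank ℚ ↥(Submodule.span ℚ {B | ∃ X' ∈ (BettiUniverse.hodge exists_isReal_hodgeModel_holds hX 1).hodgeLie,
        ∃ Y ∈ (BettiUniverse.hodge exists_isReal_hodgeModel_holds hX 1).hodgeLie, X' * Y - Y * X' = B}) ≠ 2 ∧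
    Module.finrank ℚ ↥(Submodule.span ℚ {B | ∃ X' ∈ (BettiUniverse.hodge exists_isReal_hodgeModel_holds hX 1).hodgeLie,
        ∃ Y ∈ (BettiUniverse.hodge exists_isReal_hodgeModel_holds hX 1).hodgeLie, X' * Y - Y * X' = B}) ≠ 4 ∧
    Module.finrank ℚ ↥(Submodule.span ℚ {B | ∃ X' ∈ (BettiUniverse.hodge exists_isReal_hodgeModel_holds hX 1).hodgeLie,
        ∃ Y ∈ (BettiUniverse.hodge exists_isReal_hodgeModel_holds hX 1).hodgeLie, X' * Y - Y * X' = B}) ≠ 5 ∧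
    Module.finrank ℚ ↥(Submodule.span ℚ {B | ∃ X' ∈ (BettiUniverse.hodge exists_isReal_hodgeModel_holds hX 1).hodgeLie,
        ∃ Y ∈ (BettiUniverse.hodge exists_isReal_hodgeModel_holds hX 1).hodgeLie, X' * Y - Y * X' = B}) ≠ 7 := by
  haveI := BettiUniverse.finite hX 1
  letI : LieRing (Module.End ℚ (bettiCohomology X.X 1)) := LieRing.ofAssociativeRing
  obtain ⟨𝔏, h𝔏⟩ := exists_lieSubalgebra_eq_hodgeLie_derived (BettiUniverse.hodge exists_isReal_hodgeModel_holds hX 1)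
  haveI := (isSemisimple_of_eq_hodgeLie_hodge_one_derived hX 𝔏 h𝔏).2
  haveI : Module.Finite ℚ 𝔏 := Module.Finite.of_injective 𝔏.toSubmodule.subtype Subtype.val_injective
  have h := Literature.Algebra.Lie.SemisimpleSmallDimension.finrank_ne_of_hasTrivialRadical (K := ℚ) (L := 𝔏)
  have e : Module.finrank ℚ 𝔏 = Module.finrank ℚ 𝔏.toSubmodule := rfl
  rw [e, h𝔏] at h
  exact h

/-- **`X` not of CM type ⟹ `dim [Lie Hg, Lie Hg] ≥ 3`, and `≥ 6` unless it is `3`** (the smallest semisimple Lie algebras).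
[cite: Humphreys1972, §8.4] [cite: MoonenZarhin1999LowDim, §2] -/
theorem three_le_finrank_hodgeLie_hodge_one_derived (hX : IsSmoothProjective n X.X) (hcm : ¬ IsOfCMType X) :
    haveI := BettiUniverse.finite hX 1
    3 ≤ Module.finrank ℚ ↥(Submodule.span ℚ {B | ∃ X' ∈ (BettiUniverse.hodge exists_isReal_hodgeModel_holds hX 1).hodgeLie,
        ∃ Y ∈ (BettiUniverse.hodge exists_isReal_hodgeModel_holds hX 1).hodgeLie, X' * Y - Y * X' = B}) ∧
    (Module.finrank ℚ ↥(Submodule.span ℚ {B | ∃ X' ∈ (BettiUniverse.hodge exists_isReal_hodgeModel_holds hX 1).hodgeLie,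
        ∃ Y ∈ (BettiUniverse.hodge exists_isReal_hodgeModel_holds hX 1).hodgeLie, X' * Y - Y * X' = B}) ≠ 3 →
      6 ≤ Module.finrank ℚ ↥(Submodule.span ℚ {B | ∃ X' ∈ (BettiUniverse.hodge exists_isReal_hodgeModel_holds hX 1).hodgeLie,
        ∃ Y ∈ (BettiUniverse.hodge exists_isReal_hodgeModel_holds hX 1).hodgeLie, X' * Y - Y * X' = B})) := by
  haveI := BettiUniverse.finite hX 1
  have hne := finrank_hodgeLie_hodge_one_derived_ne hX
  have h0 : Module.finrank ℚ ↥(Submodule.span ℚ {B | ∃ X' ∈ (BettiUniverse.hodge exists_isReal_hodgeModel_holds hX 1).hodgeLie,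
      ∃ Y ∈ (BettiUniverse.hodge exists_isReal_hodgeModel_holds hX 1).hodgeLie, X' * Y - Y * X' = B}) ≠ 0 := by
    intro h
    exact hcm ((isOfCMType_iff_hodgeLie_derived_eq_bot hX).2 (Submodule.finrank_eq_zero.1 h))
  omega

/-- **Every abelian ideal of `Lie Hg(H¹X)` is central**: a `ℚ`-subspace `𝔞 ⊆ 𝔥` with `[𝔥, 𝔞] ⊆ 𝔞` and `[𝔞, 𝔞] = 0` lies in
`𝔷 = 𝔥 ∩ End_Hdg(H¹X)` (complete reducibility of `H¹(X;ℂ)` under `𝔥_ℂ` and Lie's theorem,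
`le_inf_endAlg_of_abelian_ideal`). [cite: Deligne1982HodgeCycles, I §3 Prop. 3.6] [cite: MoonenZarhin1999LowDim, §1] -/
theorem hodgeLie_hodge_one_abelian_ideal_le_center (hX : IsSmoothProjective n X.X)
    {𝔞 : Submodule ℚ (Module.End ℚ (bettiCohomology X.X 1))}
    (h𝔞 : haveI := BettiUniverse.finite hX 1
      𝔞 ≤ (BettiUniverse.hodge exists_isReal_hodgeModel_holds hX 1).hodgeLie)
    (hideal : haveI := BettiUniverse.finite hX 1
      ∀ X' ∈ (BettiUniverse.hodge exists_isReal_hodgeModel_holds hX 1).hodgeLie, ∀ A ∈ 𝔞, X' * A - A * X' ∈ 𝔞)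
    (hab : ∀ A ∈ 𝔞, ∀ B ∈ 𝔞, A * B = B * A) :
    haveI := BettiUniverse.finite hX 1
    𝔞 ≤ (BettiUniverse.hodge exists_isReal_hodgeModel_holds hX 1).hodgeLie ⊓
      Subalgebra.toSubmodule (BettiUniverse.hodge exists_isReal_hodgeModel_holds hX 1).endAlg := by
  haveI := BettiUniverse.finite hX 1
  obtain ⟨ψ⟩ := BettiUniverse.hodge_isPolarizable exists_isReal_hodgeModel_holds hX 1
  exact le_inf_endAlg_of_abelian_ideal _ ψ h𝔞 hideal hab

/-! ### No factor of type IV: `Lie Hg(H¹X)` is semisimple -/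

/-- **If `X` has no simple factor of type IV, the centre of `Lie Hg(H¹X)` vanishes: `Lie Hg ∩ End_Hdg = 0`** — its elements are
`ψ`-skew CENTRAL Hodge endomorphisms (`𝔥` commutes with `End_Hdg`, `𝔥 ⊆ 𝔰𝔭(ψ)`), and those vanish when the centre of
`End⁰(X)` is totally real (`forall_central_skew_eq_zero_hodge_one_of_hasNoTypeIVFactor`: the Rosati involution is the
identity on a totally real centre). Moonen–Zarhin §1: «If `X` has no factors of Type 4 then `Hg(X)` is semi-simple».
[cite: MoonenZarhin1999LowDim, §1] -/
theorem hodgeLie_hodge_one_inf_endAlg_eq_bot_of_hasNoTypeIVFactor (hX : IsSmoothProjective n X.X)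
    (hA4 : HasNoTypeIVFactor X) :
    haveI := BettiUniverse.finite hX 1
    (BettiUniverse.hodge exists_isReal_hodgeModel_holds hX 1).hodgeLie ⊓
      Subalgebra.toSubmodule (BettiUniverse.hodge exists_isReal_hodgeModel_holds hX 1).endAlg = ⊥ := by
  have hn : X.dim = n := schemeDim_eq_holds hX
  subst hn
  haveI := BettiUniverse.finite hX 1
  obtain ⟨ψ⟩ := BettiUniverse.hodge_isPolarizable exists_isReal_hodgeModel_holds hX 1
  have hE := forall_central_skew_eq_zero_hodge_one_of_hasNoTypeIVFactor hA4 exists_isReal_hodgeModel_holds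
    hodgePQ_independent_of_hodgeModel_holds ψ
  rw [Submodule.eq_bot_iff]
  intro Z hZ
  rw [Submodule.mem_inf, Subalgebra.mem_toSubmodule] at hZ
  refine hE Z hZ.2 (fun b hb => commute_of_mem_hodgeLie _ hZ.1 ⟨b, hb⟩) fun v w =>
    form_apply_add_eq_zero_of_mem_hodgeLie ψ hZ.1 v w

/-- **No type IV ⟹ `Lie Hg(H¹X) = [Lie Hg, Lie Hg]`** (the centre vanishes). [cite: MoonenZarhin1999LowDim, §1] -/
theorem hodgeLie_hodge_one_derived_eq_of_hasNoTypeIVFactor (hX : IsSmoothProjective n X.X) (hA4 : HasNoTypeIVFactor X) :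
    haveI := BettiUniverse.finite hX 1
    Submodule.span ℚ {B | ∃ X' ∈ (BettiUniverse.hodge exists_isReal_hodgeModel_holds hX 1).hodgeLie,
        ∃ Y ∈ (BettiUniverse.hodge exists_isReal_hodgeModel_holds hX 1).hodgeLie, X' * Y - Y * X' = B} =
      (BettiUniverse.hodge exists_isReal_hodgeModel_holds hX 1).hodgeLie := by
  have h := hodgeLie_hodge_one_center_sup_derived hX
  rw [hodgeLie_hodge_one_inf_endAlg_eq_bot_of_hasNoTypeIVFactor hX hA4, bot_sup_eq] at h
  exact h

/-- **No type IV ⟹ `Lie Hg(H¹X)` is a semisimple Lie algebra** (`LieAlgebra.IsSemisimple ℚ` and `HasTrivialRadical` for every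
Lie subalgebra of `𝔤𝔩(H¹X)` with carrier `Lie Hg(H¹X)`). Moonen–Zarhin §1, Lie form. [cite: MoonenZarhin1999LowDim, §1]
[cite: Deligne1982HodgeCycles, I §3 Prop. 3.6] -/
theorem isSemisimple_of_eq_hodgeLie_hodge_one_of_hasNoTypeIVFactor (hX : IsSmoothProjective n X.X)
    (hA4 : HasNoTypeIVFactor X) :
    haveI := BettiUniverse.finite hX 1
    letI : LieRing (Module.End ℚ (bettiCohomology X.X 1)) := LieRing.ofAssociativeRing
    ∀ 𝔏 : LieSubalgebra ℚ (Module.End ℚ (bettiCohomology X.X 1)),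
      𝔏.toSubmodule = (BettiUniverse.hodge exists_isReal_hodgeModel_holds hX 1).hodgeLie →
      LieAlgebra.IsSemisimple ℚ 𝔏 ∧ LieAlgebra.HasTrivialRadical ℚ 𝔏 := by
  haveI := BettiUniverse.finite hX 1
  letI : LieRing (Module.End ℚ (bettiCohomology X.X 1)) := LieRing.ofAssociativeRing
  intro 𝔏 h𝔏
  rw [← hodgeLie_hodge_one_derived_eq_of_hasNoTypeIVFactor hX hA4] at h𝔏
  exact isSemisimple_of_eq_hodgeLie_hodge_one_derived hX 𝔏 h𝔏

/-- **No type IV ⟹ `dim Lie Hg(H¹X) ∉ {1, 2, 4, 5, 7}` and `dim MT(H¹X) ∉ {2, 3, 5, 6, 8}`** (`0 < dim X`).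
[cite: MoonenZarhin1999LowDim, §1–§2] [cite: Humphreys1972, §8.4] -/
theorem mtRank_hodge_one_ne_of_hasNoTypeIVFactor (hX : IsSmoothProjective n X.X) (h0 : 0 < X.dim)
    (hA4 : HasNoTypeIVFactor X) :
    haveI := BettiUniverse.finite hX 1
    (BettiUniverse.hodge exists_isReal_hodgeModel_holds hX 1).mtRank ≠ 2 ∧
      (BettiUniverse.hodge exists_isReal_hodgeModel_holds hX 1).mtRank ≠ 3 ∧
      (BettiUniverse.hodge exists_isReal_hodgeModel_holds hX 1).mtRank ≠ 5 ∧
      (BettiUniverse.hodge exists_isReal_hodgeModel_holds hX 1).mtRank ≠ 6 ∧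
      (BettiUniverse.hodge exists_isReal_hodgeModel_holds hX 1).mtRank ≠ 8 := by
  haveI := BettiUniverse.finite hX 1
  have h1 := mtRank_hodge_one_eq_center_add_derived_add_one hX h0
  have h2 := finrank_hodgeLie_hodge_one_derived_ne hX
  have h3 : Module.finrank ℚ ↥((BettiUniverse.hodge exists_isReal_hodgeModel_holds hX 1).hodgeLie ⊓
      Subalgebra.toSubmodule (BettiUniverse.hodge exists_isReal_hodgeModel_holds hX 1).endAlg) = 0 := by
    rw [hodgeLie_hodge_one_inf_endAlg_eq_bot_of_hasNoTypeIVFactor hX hA4, finrank_bot]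
  omega

end Summit.HodgeConjecture.CorCM

end
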